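import Mathlib
import HarnessLib
import Summits.Ventures.LatticeQCDFlow.Scaling.AcceptanceVolumeCeilingRigidityIntegralEq
import Summits.Ventures.LatticeQCDFlow.Scaling.U1IdentityFlowStrict

/-!
# LatticeQCDFlow / Scaling — the acceptance of a factorised flow is STRICTLY DECREASING in the
# number of imperfect blocks; the untrained U(1) sampler has `acc_{V+1} < acc_V`

HONEST FRAMING: exact (Metropolis-corrected) sampling algorithms for lattice gauge theory;
figures of merit are autocorrelation/cost numbers at stated couplings and volumes; no
continuum-physics claim.

Venture `LatticeQCDFlow` (cell pub-lqcd), topic `Scaling`; FANOUT row 3 (`s0-u1-a`, S0-B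
implementation A, GEN-14).  NEW WORK of the cell (elementary measure theory), built on row 3's
general-space worst-block ceiling and its rigidity (`Scaling/AcceptanceVolumeSandwichIntegral`,
`Scaling/AcceptanceVolumeCeilingRigidityIntegralEq`, imported) and on Mathlib's measure-preserving
split `MeasurableEquiv.piFinSuccAbove` of an `(m+1)`-fold product into its first block and the tail.
SETTING: s-finite / σ-finite reference measures, targets `p ≥ 0` with `∫ = 1`, models `q > 0` with
probability laws, `acc(p, q) = ∫∫ min(p(a)q(b), p(b)q(a))`.  NO definition is introduced.

* §1 **`meanAccept_prod_swap`** — `acc(p⊗p′, q⊗q′)` on `X × Y` equals `acc(p′⊗p, q′⊗q)` on `Y × X`;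
  hence the RIGHT versions of row 3's two-block ceiling and rigidity:
  `meanAccept_prod_le_meanAccept_right` (`acc(p⊗p′, q⊗q′) ≤ acc(p′, q′)`),
  **`meanAccept_prod_eq_meanAccept_right_iff`** (`= acc(p′, q′) ↔ p =ᵐ q`),
  `meanAccept_prod_lt_meanAccept_right`;
* §2 `m + 1` blocks of one state space `Y` (block laws `μ i`, densities `p i`, `q i`,
  `i : Fin (m+1)`): **`meanAccept_pi_succ_eq_meanAccept_prod`** — the acceptance of the
  `(m+1)`-block flow IS the two-block acceptance of (block `0`) ⊗ (the `m`-block tail)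
  (`measurePreserving_piFinSuccAbove`, `Fin.prod_univ_succ`); hence
  **`meanAccept_pi_succ_le_tail`** (gluing block `0` to the tail can only cost),
  **`meanAccept_pi_succ_eq_tail_iff`** (`=` iff block `0` is perfect, `p 0 =ᵐ q 0`) and
  **`meanAccept_pi_succ_lt_tail`** (an imperfect block `0` costs STRICTLY);
* §3 the untrained U(1) sampler at `β ≠ 0` (row 3's `Scaling/U1IdentityFlowVolumeLaw`,
  `not_u1Wilson_ae_eq_u1Haar`): **`u1IdentityFlow_meanAccept_succ_lt`** — `acc_{V+1} < acc_V` for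
  every `V`: the equilibrium acceptance of fresh-Haar proposals against `V` independent Wilson
  plaquette weights is STRICTLY DECREASING in the volume (GEN-12 gave the two-sided geometric
  envelope; strict monotonicity is new).

Reading (value-free): every additional independently proposed imperfect block strictly lowers the
equilibrium acceptance of an exact flow sampler, on any configuration space; for the untrained U(1)
baseline this is the strict volume monotonicity `acc_{V+1} < acc_V`.  NOT CLAIMED: the size of the
decrement; dependent block types in §2 (one common block space `Y`, as in every identical-block law
of the cell); any acceptance VALUE of ours; nothing re-scored.
-/

noncomputable section

namespace Summit.Ventures.LatticeQCDFlow.Theory2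

open MeasureTheory Real Set Finset Filter
open Summit.Ventures.LatticeQCDFlow.Scoring (onePlaquetteZ onePlaquetteZ_pos)

/-! ## §1 Swapping the two blocks; the right versions of the ceiling and its rigidity -/

section Swap

variable {X Y : Type*} [MeasurableSpace X] [MeasurableSpace Y] {μ : Measure X} {μ' : Measure Y}
  [SFinite μ] [SFinite μ'] {p q : X → ℝ} {p' q' : Y → ℝ}

/-- **Swapping the blocks**: `acc(p⊗p′, q⊗q′)` computed on `X × Y` equals `acc(p′⊗p, q′⊗q)` computed
on `Y × X` (the swap `X × Y ≃ᵐ Y × X` is measure preserving; no hypothesis on the densities).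
[folklore] -/
theorem meanAccept_prod_swap (p q : X → ℝ) (p' q' : Y → ℝ) :
    ∫ z, ∫ z', min (p z.1 * p' z.2 * (q z'.1 * q' z'.2)) (p z'.1 * p' z'.2 * (q z.1 * q' z.2))
        ∂(μ.prod μ') ∂(μ.prod μ')
      = ∫ u, ∫ u', min (p' u.1 * p u.2 * (q' u'.1 * q u'.2)) (p' u'.1 * p u'.2 * (q' u.1 * q u.2))
          ∂(μ'.prod μ) ∂(μ'.prod μ) := by
  have hS : MeasurePreserving (MeasurableEquiv.prodComm : Y × X ≃ᵐ X × Y) (μ'.prod μ) (μ.prod μ') :=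
    Measure.measurePreserving_swap
  have inner : ∀ z : X × Y,
      ∫ z', min (p z.1 * p' z.2 * (q z'.1 * q' z'.2)) (p z'.1 * p' z'.2 * (q z.1 * q' z.2)) ∂(μ.prod μ')
        = ∫ u', min (p z.1 * p' z.2 * (q' u'.1 * q u'.2)) (p' u'.1 * p u'.2 * (q z.1 * q' z.2))
            ∂(μ'.prod μ) := by
    intro z
    rw [← hS.integral_comp']
    refine integral_congr_ae (Eventually.of_forall fun u' => ?_)
    simp only [MeasurableEquiv.prodComm, MeasurableEquiv.coe_mk, Equiv.prodComm_apply, Prod.fst_swap,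
      Prod.snd_swap]
    ring_nf
  simp_rw [inner]
  rw [← hS.integral_comp']
  refine integral_congr_ae (Eventually.of_forall fun u => ?_)
  simp only [MeasurableEquiv.prodComm, MeasurableEquiv.coe_mk, Equiv.prodComm_apply, Prod.fst_swap,
    Prod.snd_swap]
  refine integral_congr_ae (Eventually.of_forall fun u' => ?_)
  ring_nf

/-- **A block can only cost acceptance (right version)**: `acc(p⊗p′, q⊗q′) ≤ acc(p′, q′)`. [ours] -/
theorem meanAccept_prod_le_meanAccept_right (hp0 : ∀ x, 0 ≤ p x) (hpm : Measurable p)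
    (hpi : Integrable p μ) (hp1 : ∫ x, p x ∂μ = 1) (hq0 : ∀ x, 0 < q x) (hqm : Measurable q)
    (hqi : Integrable q μ) (hp0' : ∀ y, 0 ≤ p' y) (hpm' : Measurable p') (hpi' : Integrable p' μ')
    (hq0' : ∀ y, 0 < q' y) (hqm' : Measurable q') (hqi' : Integrable q' μ')
    [IsProbabilityMeasure (μ.withDensity fun x => ENNReal.ofReal (q x))]
    [IsProbabilityMeasure (μ'.withDensity fun y => ENNReal.ofReal (q' y))] :
    ∫ z, ∫ z', min (p z.1 * p' z.2 * (q z'.1 * q' z'.2)) (p z'.1 * p' z'.2 * (q z.1 * q' z.2))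
        ∂(μ.prod μ') ∂(μ.prod μ')
      ≤ ∫ c, ∫ d, min (p' c * q' d) (p' d * q' c) ∂μ' ∂μ' := by
  rw [meanAccept_prod_swap]
  exact meanAccept_prod_le_meanAccept_left hp0' hpm' hpi' hq0' hqm' hqi' hp0 hpm hpi hp1 hq0 hqm hqi

/-- **Rigidity of the worst-block ceiling (right version)**: `acc(p⊗p′, q⊗q′) = acc(p′, q′)` iff the
first block is perfect, `p =ᵐ[μ] q`. [ours] -/
theorem meanAccept_prod_eq_meanAccept_right_iff (hp0 : ∀ x, 0 ≤ p x) (hpm : Measurable p)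
    (hpi : Integrable p μ) (hp1 : ∫ x, p x ∂μ = 1) (hq0 : ∀ x, 0 < q x) (hqm : Measurable q)
    (hqi : Integrable q μ) (hp0' : ∀ y, 0 ≤ p' y) (hpm' : Measurable p') (hpi' : Integrable p' μ')
    (hp1' : ∫ y, p' y ∂μ' = 1) (hq0' : ∀ y, 0 < q' y) (hqm' : Measurable q') (hqi' : Integrable q' μ')
    [IsProbabilityMeasure (μ.withDensity fun x => ENNReal.ofReal (q x))]
    [IsProbabilityMeasure (μ'.withDensity fun y => ENNReal.ofReal (q' y))] :
    ∫ z, ∫ z', min (p z.1 * p' z.2 * (q z'.1 * q' z'.2)) (p z'.1 * p' z'.2 * (q z.1 * q' z.2))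
        ∂(μ.prod μ') ∂(μ.prod μ') = ∫ c, ∫ d, min (p' c * q' d) (p' d * q' c) ∂μ' ∂μ'
      ↔ p =ᵐ[μ] q := by
  rw [meanAccept_prod_swap]
  exact meanAccept_prod_eq_meanAccept_left_iff hp0' hpm' hpi' hp1' hq0' hqm' hqi' hp0 hpm hpi hp1 hq0
    hqm hqi

/-- **An imperfect first block costs strictly (right version)**. [ours] -/
theorem meanAccept_prod_lt_meanAccept_right (hp0 : ∀ x, 0 ≤ p x) (hpm : Measurable p)
    (hpi : Integrable p μ) (hp1 : ∫ x, p x ∂μ = 1) (hq0 : ∀ x, 0 < q x) (hqm : Measurable q)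
    (hqi : Integrable q μ) (hp0' : ∀ y, 0 ≤ p' y) (hpm' : Measurable p') (hpi' : Integrable p' μ')
    (hp1' : ∫ y, p' y ∂μ' = 1) (hq0' : ∀ y, 0 < q' y) (hqm' : Measurable q') (hqi' : Integrable q' μ')
    [IsProbabilityMeasure (μ.withDensity fun x => ENNReal.ofReal (q x))]
    [IsProbabilityMeasure (μ'.withDensity fun y => ENNReal.ofReal (q' y))] (h : ¬ p =ᵐ[μ] q) :
    ∫ z, ∫ z', min (p z.1 * p' z.2 * (q z'.1 * q' z'.2)) (p z'.1 * p' z'.2 * (q z.1 * q' z.2))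
        ∂(μ.prod μ') ∂(μ.prod μ') < ∫ c, ∫ d, min (p' c * q' d) (p' d * q' c) ∂μ' ∂μ' := by
  rw [meanAccept_prod_swap]
  exact meanAccept_prod_lt_meanAccept_left hp0' hpm' hpi' hp1' hq0' hqm' hqi' hp0 hpm hpi hp1 hq0
    hqm hqi h

end Swap

/-! ## §2 `m + 1` blocks = (block `0`) ⊗ (the `m`-block tail) -/

section Succ

variable {Y : Type*} [MeasurableSpace Y] {m : ℕ} {μ : Fin (m + 1) → Measure Y}
  [∀ i, SigmaFinite (μ i)] {p q : Fin (m + 1) → Y → ℝ}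

/-- Splitting off block `0`: the product density evaluated at the re-assembled configuration.
[folklore] -/
theorem prod_piFinSuccAbove_symm (f : Fin (m + 1) → Y → ℝ) (z : Y × (Fin m → Y)) :
    ∏ i, f i ((MeasurableEquiv.piFinSuccAbove (fun _ : Fin (m + 1) => Y) 0).symm z i)
      = f 0 z.1 * ∏ j : Fin m, f j.succ (z.2 j) := by
  rw [Fin.prod_univ_succ]
  simp [MeasurableEquiv.piFinSuccAbove, Fin.insertNthEquiv, Fin.insertNth_zero']

/-- **THE `(m+1)`-BLOCK ACCEPTANCE IS A TWO-BLOCK ACCEPTANCE**: block `0` against the `m`-block tail,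
`acc(⊗_{i ≤ m} pᵢ, ⊗ qᵢ) = acc(p₀ ⊗ (⊗_{j<m} p_{j+1}), q₀ ⊗ (⊗ q_{j+1}))` on `Y × (Fin m → Y)`
(Mathlib's measure-preserving `piFinSuccAbove`). [ours] -/
theorem meanAccept_pi_succ_eq_meanAccept_prod (p q : Fin (m + 1) → Y → ℝ) :
    ∫ x, ∫ x', min ((∏ i, p i (x i)) * ∏ i, q i (x' i)) ((∏ i, p i (x' i)) * ∏ i, q i (x i))
        ∂(Measure.pi μ) ∂(Measure.pi μ)
      = ∫ z, ∫ z', min (p 0 z.1 * (∏ j : Fin m, p j.succ (z.2 j))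
            * (q 0 z'.1 * ∏ j : Fin m, q j.succ (z'.2 j)))
          (p 0 z'.1 * (∏ j : Fin m, p j.succ (z'.2 j)) * (q 0 z.1 * ∏ j : Fin m, q j.succ (z.2 j)))
          ∂((μ 0).prod (Measure.pi fun j : Fin m => μ j.succ))
          ∂((μ 0).prod (Measure.pi fun j : Fin m => μ j.succ)) := by
  have hE := (measurePreserving_piFinSuccAbove μ 0).symm
    (MeasurableEquiv.piFinSuccAbove (fun _ : Fin (m + 1) => Y) 0)
  simp only [Fin.succAbove_zero] at hE
  rw [← hE.integral_comp']
  refine integral_congr_ae (Eventually.of_forall fun z => ?_)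
  dsimp only
  rw [← hE.integral_comp']
  refine integral_congr_ae (Eventually.of_forall fun z' => ?_)
  dsimp only
  rw [prod_piFinSuccAbove_symm, prod_piFinSuccAbove_symm, prod_piFinSuccAbove_symm,
    prod_piFinSuccAbove_symm]

variable [IsProbabilityMeasure ((μ 0).withDensity fun y => ENNReal.ofReal (q 0 y))]
  [IsProbabilityMeasure ((Measure.pi fun j : Fin m => μ j.succ).withDensity
    fun y => ENNReal.ofReal (∏ j : Fin m, q j.succ (y j)))]

/-- **GLUING BLOCK `0` TO THE TAIL CAN ONLY COST**: `acc(⊗_{i ≤ m}) ≤ acc(⊗ tail)`. [ours] -/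
theorem meanAccept_pi_succ_le_tail (hp0 : ∀ i a, 0 ≤ p i a) (hpm : ∀ i, Measurable (p i))
    (hpi : ∀ i, Integrable (p i) (μ i)) (hp1 : ∀ i, ∫ a, p i a ∂(μ i) = 1)
    (hq0 : ∀ i a, 0 < q i a) (hqm : ∀ i, Measurable (q i)) (hqi : ∀ i, Integrable (q i) (μ i)) :
    ∫ x, ∫ x', min ((∏ i, p i (x i)) * ∏ i, q i (x' i)) ((∏ i, p i (x' i)) * ∏ i, q i (x i))
        ∂(Measure.pi μ) ∂(Measure.pi μ)
      ≤ ∫ y, ∫ y', min ((∏ j : Fin m, p j.succ (y j)) * ∏ j : Fin m, q j.succ (y' j))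
          ((∏ j : Fin m, p j.succ (y' j)) * ∏ j : Fin m, q j.succ (y j))
          ∂(Measure.pi fun j : Fin m => μ j.succ) ∂(Measure.pi fun j : Fin m => μ j.succ) := by
  obtain ⟨hP0, hPm, hPi, hP1⟩ := piDensity_facts (μ := fun j : Fin m => μ j.succ)
    (p := fun j => p j.succ) (fun j => hp0 j.succ) (fun j => hpm j.succ) fun j => hpi j.succ
  obtain ⟨-, hQm, hQi, -⟩ := piDensity_facts (μ := fun j : Fin m => μ j.succ)
    (p := fun j => q j.succ) (fun j a => (hq0 j.succ a).le) (fun j => hqm j.succ) fun j => hqi j.succ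
  have hP1' : ∫ y, ∏ j : Fin m, p j.succ (y j) ∂(Measure.pi fun j : Fin m => μ j.succ) = 1 := by
    rw [hP1]
    exact prod_eq_one fun j _ => hp1 j.succ
  have hQ0 : ∀ y : Fin m → Y, 0 < ∏ j : Fin m, q j.succ (y j) :=
    fun y => prod_pos fun j _ => hq0 j.succ (y j)
  rw [meanAccept_pi_succ_eq_meanAccept_prod]
  exact meanAccept_prod_le_meanAccept_right (hp0 0) (hpm 0) (hpi 0) (hp1 0) (hq0 0) (hqm 0) (hqi 0)
    hP0 hPm hPi hQ0 hQm hQi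

/-- **RIGIDITY**: `acc(⊗_{i ≤ m}) = acc(⊗ tail)` iff block `0` is perfect, `p 0 =ᵐ[μ 0] q 0`. [ours] -/
theorem meanAccept_pi_succ_eq_tail_iff (hp0 : ∀ i a, 0 ≤ p i a) (hpm : ∀ i, Measurable (p i))
    (hpi : ∀ i, Integrable (p i) (μ i)) (hp1 : ∀ i, ∫ a, p i a ∂(μ i) = 1)
    (hq0 : ∀ i a, 0 < q i a) (hqm : ∀ i, Measurable (q i)) (hqi : ∀ i, Integrable (q i) (μ i)) :
    ∫ x, ∫ x', min ((∏ i, p i (x i)) * ∏ i, q i (x' i)) ((∏ i, p i (x' i)) * ∏ i, q i (x i))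
        ∂(Measure.pi μ) ∂(Measure.pi μ)
      = ∫ y, ∫ y', min ((∏ j : Fin m, p j.succ (y j)) * ∏ j : Fin m, q j.succ (y' j))
          ((∏ j : Fin m, p j.succ (y' j)) * ∏ j : Fin m, q j.succ (y j))
          ∂(Measure.pi fun j : Fin m => μ j.succ) ∂(Measure.pi fun j : Fin m => μ j.succ)
      ↔ p 0 =ᵐ[μ 0] q 0 := by
  obtain ⟨hP0, hPm, hPi, hP1⟩ := piDensity_facts (μ := fun j : Fin m => μ j.succ)
    (p := fun j => p j.succ) (fun j => hp0 j.succ) (fun j => hpm j.succ) fun j => hpi j.succ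
  obtain ⟨-, hQm, hQi, -⟩ := piDensity_facts (μ := fun j : Fin m => μ j.succ)
    (p := fun j => q j.succ) (fun j a => (hq0 j.succ a).le) (fun j => hqm j.succ) fun j => hqi j.succ
  have hP1' : ∫ y, ∏ j : Fin m, p j.succ (y j) ∂(Measure.pi fun j : Fin m => μ j.succ) = 1 := by
    rw [hP1]
    exact prod_eq_one fun j _ => hp1 j.succ
  have hQ0 : ∀ y : Fin m → Y, 0 < ∏ j : Fin m, q j.succ (y j) :=
    fun y => prod_pos fun j _ => hq0 j.succ (y j)
  rw [meanAccept_pi_succ_eq_meanAccept_prod]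
  exact meanAccept_prod_eq_meanAccept_right_iff (hp0 0) (hpm 0) (hpi 0) (hp1 0) (hq0 0) (hqm 0)
    (hqi 0) hP0 hPm hPi hP1' hQ0 hQm hQi

/-- **AN IMPERFECT BLOCK `0` COSTS STRICTLY**: `acc(⊗_{i ≤ m}) < acc(⊗ tail)` when `¬ p 0 =ᵐ q 0`.
[ours] -/
theorem meanAccept_pi_succ_lt_tail (hp0 : ∀ i a, 0 ≤ p i a) (hpm : ∀ i, Measurable (p i))
    (hpi : ∀ i, Integrable (p i) (μ i)) (hp1 : ∀ i, ∫ a, p i a ∂(μ i) = 1)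
    (hq0 : ∀ i a, 0 < q i a) (hqm : ∀ i, Measurable (q i)) (hqi : ∀ i, Integrable (q i) (μ i))
    (h : ¬ p 0 =ᵐ[μ 0] q 0) :
    ∫ x, ∫ x', min ((∏ i, p i (x i)) * ∏ i, q i (x' i)) ((∏ i, p i (x' i)) * ∏ i, q i (x i))
        ∂(Measure.pi μ) ∂(Measure.pi μ)
      < ∫ y, ∫ y', min ((∏ j : Fin m, p j.succ (y j)) * ∏ j : Fin m, q j.succ (y' j))
          ((∏ j : Fin m, p j.succ (y' j)) * ∏ j : Fin m, q j.succ (y j))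
          ∂(Measure.pi fun j : Fin m => μ j.succ) ∂(Measure.pi fun j : Fin m => μ j.succ) := by
  refine lt_of_le_of_ne (meanAccept_pi_succ_le_tail hp0 hpm hpi hp1 hq0 hqm hqi) fun heq => ?_
  exact h ((meanAccept_pi_succ_eq_tail_iff hp0 hpm hpi hp1 hq0 hqm hqi).1 heq)

end Succ

/-! ## §3 The untrained U(1) sampler: `acc_{V+1} < acc_V` -/

section U1

/-- The Haar model law of one plaquette, `(1/(2π)) dθ` on `(0, 2π]`, is a probability measure.
[folklore] -/
theorem isProbabilityMeasure_u1Haar :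
    IsProbabilityMeasure ((volume.restrict (Ioc (0 : ℝ) (2 * π))).withDensity
      fun _ => ENNReal.ofReal (1 / (2 * π) : ℝ)) := by
  refine ⟨?_⟩
  rw [withDensity_apply _ MeasurableSet.univ, Measure.restrict_univ, setLIntegral_const,
    Real.volume_Ioc, ← ENNReal.ofReal_mul (by positivity),
    show (1 / (2 * π) : ℝ) * (2 * π - 0) = 1 by rw [sub_zero]; field_simp]
  exact ENNReal.ofReal_one

/-- The product Haar model law of `V` plaquettes is a probability measure (in the density form used
by the two-block theorems). [folklore] -/
theorem isProbabilityMeasure_u1Haar_pi (V : ℕ) :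
    IsProbabilityMeasure ((Measure.pi fun _ : Fin V => volume.restrict (Ioc (0 : ℝ) (2 * π))).withDensity
      fun _ => ENNReal.ofReal (∏ _j : Fin V, (1 / (2 * π) : ℝ))) := by
  refine ⟨?_⟩
  rw [withDensity_apply _ MeasurableSet.univ, Measure.restrict_univ, lintegral_const, Measure.pi_univ]
  simp_rw [Measure.restrict_apply_univ, Real.volume_Ioc]
  rw [prod_const, prod_const, card_univ, Fintype.card_fin, ENNReal.ofReal_pow (by positivity),
    ← mul_pow, ← ENNReal.ofReal_mul (by positivity),
    show (1 / (2 * π) : ℝ) * (2 * π - 0) = 1 by rw [sub_zero]; field_simp, ENNReal.ofReal_one, one_pow]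

/-- **THE UNTRAINED U(1) ACCEPTANCE IS STRICTLY DECREASING IN THE VOLUME**: for `β ≠ 0` and every
`V`, `acc_{V+1} < acc_V` — the equilibrium acceptance of the exact sampler proposing `V + 1`
independent plaquette angles from the Haar prior against the product Wilson weight is strictly below
the one for `V` plaquettes (the glued plaquette is imperfect: `not_u1Wilson_ae_eq_u1Haar`). [ours] -/
theorem u1IdentityFlow_meanAccept_succ_lt {β : ℝ} (hβ : β ≠ 0) (V : ℕ) :
    ∫ x, ∫ x', min ((∏ i : Fin (V + 1), Real.exp (β * Real.cos (x i)) / onePlaquetteZ β)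
          * ∏ _i : Fin (V + 1), (1 / (2 * π) : ℝ))
        ((∏ i : Fin (V + 1), Real.exp (β * Real.cos (x' i)) / onePlaquetteZ β)
          * ∏ _i : Fin (V + 1), (1 / (2 * π) : ℝ))
        ∂(Measure.pi fun _ : Fin (V + 1) => volume.restrict (Ioc (0 : ℝ) (2 * π)))
        ∂(Measure.pi fun _ : Fin (V + 1) => volume.restrict (Ioc (0 : ℝ) (2 * π)))
      < ∫ y, ∫ y', min ((∏ j : Fin V, Real.exp (β * Real.cos (y j)) / onePlaquetteZ β)
            * ∏ _j : Fin V, (1 / (2 * π) : ℝ))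
          ((∏ j : Fin V, Real.exp (β * Real.cos (y' j)) / onePlaquetteZ β)
            * ∏ _j : Fin V, (1 / (2 * π) : ℝ))
          ∂(Measure.pi fun _ : Fin V => volume.restrict (Ioc (0 : ℝ) (2 * π)))
          ∂(Measure.pi fun _ : Fin V => volume.restrict (Ioc (0 : ℝ) (2 * π))) := by
  haveI := isProbabilityMeasure_u1Haar
  haveI := isProbabilityMeasure_u1Haar_pi V
  exact meanAccept_pi_succ_lt_tail (μ := fun _ : Fin (V + 1) => volume.restrict (Ioc (0 : ℝ) (2 * π)))
    (p := fun _ θ => Real.exp (β * Real.cos θ) / onePlaquetteZ β) (q := fun _ _ => (1 / (2 * π) : ℝ))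
    (fun _ θ => (u1Wilson_pos β θ).le) (fun _ => measurable_u1Wilson β)
    (fun _ => integrable_u1Wilson β) (fun _ => integral_u1Wilson β) (fun _ _ => by positivity)
    (fun _ => measurable_const) (fun _ => integrable_u1Haar) (not_u1Wilson_ae_eq_u1Haar hβ)

end U1

end Summit.Ventures.LatticeQCDFlow.Theory2
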